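import Mathlib
import Literature.Computability.Complexity.CircuitLightCone
import Literature.Computability.MetaComplexity.GapMCSPLightConeLowerBound
import Literature.Computability.MetaComplexity.FarFromSparseJuntaBounds
import Literature.Computability.MetaComplexity.FormulaXorAffineBounds
import Literature.Computability.MetaComplexity.OliveiraPichSanthanam2019.GapMKtPConstantDepth
import Literature.Computability.MetaComplexity.OliveiraPichSanthanam2019.GapMKtPFormulaBPJuntaBounds
import Literature.Computability.MetaComplexity.SearchMCSPLightConeLowerBound
import Literature.Computability.MetaComplexity.ChenJinWilliams2019.SearchMagnificationModels
import HarnessLib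

/-!
# Wires bound the light cone: `Gap-MKtP`, `search-MCSP` and `search-MKtP` against threshold
circuits with sublinearly many WIRES (rows R20 item 4 and R52 item 7 of the gap census, KNOWN side)

Sources: I. C. Oliveira, J. Pich, R. Santhanam, *Hardness magnification near state-of-the-art lower
bounds*, Theory of Computing 17 (2021), Thm. 1.1 item 4 (hypothesis `Gap-MKtP ∉ MAJ-circuits of
depth 2d'+d+1 with N^{1+2/d'+ε}` WIRES, typed `OliveiraPichSanthanam2019.MKtPMajHypothesis` over
`GapMKtPTCWiresLB U D c κ β = Gap-MKtP[N^β, N^β + c log N] ∉ promiseLift (TCdWIRESae D ⌊N^κ⌋)`);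
L. Chen, C. Jin, R. Williams, *Hardness magnification for all sparse NP languages*, FOCS 2019 /
ECCC TR19-118, Thm. 1.6 item 7 (`search-MCSP[2^{βm}]`, `search-MKtP[n^β]` vs `TC_{d+O(log 1/ε)}`
with `n^{1+ε}` WIRES, typed `ChenJinWilliams2019.tcWireFns D w`); S. Jukna, *Boolean Function
Complexity* (2012), §1.2 (wires = total fan-in). The mathematics below is folklore and FULLY PROVED
(no named fact): it is the KNOWN column of those census rows in the rows' own models.

THE DEVICE (wires light cone). Every dependency set of a gate program consists of input variables
wired DIRECTLY into some gate (`GateList.getD_deps_subset_inputsRead`), and there are at most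
`wires = Σ fan-in` of those (`GateList.card_inputsRead_le`). Hence **a circuit with `w` wires reads at
most `w + 1` input variables** (`Circuit.card_lightCone_le_wires_succ`; the `+1` covers an output wire
that is itself an input), WHATEVER its gates (threshold, modular, unbounded fan-in) and depth. A
`(w+1)`-junta is constant on `≥ 2^{N-w-1}` inputs through any point
(`Circuit.two_pow_le_card_filter_eval_eq`), which no solver of a promise problem with a YES instance
and `< 2^{N-w-1}` non-NO instances can afford (`AtseriasMuller2025.not_solvesPromise_of_card_lt`,
`OliveiraSanthanam2018.not_mem_promiseLift_FamilyAE_of_frequently`).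

RESULTS (all `[folklore]`, proved):
* `not_mem_promiseLift_TCdWIRESae_of_frequently` — the family form for `TCdWIRESae D s`, every `D`.
* Row R20 item 4: `OliveiraPichSanthanam2019.gapMKtP_not_mem_TCdWIRESae_sublinear` —
  `Gap-MKtP[N^β, N^β + c log N] ∉ promiseLift (TCdWIRESae D (N - ⌈N^{β'}⌉))` for `0 < β < β' < 1` and
  EVERY depth `D`; in the row's vocabulary `gapMKtPTCWiresLB_of_lt_one : κ < 1 → 0 < β → β < 1 →
  GapMKtPTCWiresLB U D c κ β` and `gapMKtP_tcWires_known_forall` (the `∃ β₀ ∀ β < β₀` shape, `β₀ = 1`).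
  NEEDED (Thm. 1.1 item 4): exponent `majExp d' ε = 1 + 2/d' + ε` at depth `majDepth d d' = 2d'+d+1`.
  Same-model gap: wires exponent `1⁻` known (every depth) versus `1 + 2/d' + ε` needed.
* Row R52 item 7: `ChenJinWilliams2019.not_searchMCSPSolvableAt_tcWires` (single length),
  `searchMCSP_tcWires_known_sublinear` (every `s` in the regime of Thm. 1.6),
  `eventually_not_searchMCSPSolvableAt_tcWires_twoPowFloor` (the row's own `s(m) = ⌊2^{βm}⌋`):
  `search-MCSP` is not solved with `N - ⌈N^{β'}⌉` wires PER OUTPUT BIT at any depth; and the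
  `search-MKtP[⌊n^β⌋]` twin `eventually_not_searchMKtPSolvableAt_tcWires_rpowFloor`. NEEDED: `⌈N^{1+ε}⌉`
  wires at depth `tcDepth c₀ d ε` for SOME `ε ∈ (0,1)`; the budgets never cross
  (`sub_ceil_lt_powCeil`).

HONEST CEILING. The device sees only the light cone, so it cannot pass `N - 1` wires (a single
`MAJ` gate of fan-in `N` reads everything): exponent `< 1` is the method's limit, and print's
super-linear wire bounds for threshold circuits (Impagliazzo–Paturi–Saks 1997 for PARITY,
`N^{1+ε_d}`; Hatami–Hoza–Tal–Tell 2021 Cor. 1.3 for `MCSP` at near-maximal thresholds, census row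
R62) concern other functions / parameters (census F3: PROBLEM/PARAM-MISMATCH for these rows).
-/

open Finset Filter Topology

namespace Literature.Computability.Complexity

variable {ι : Type*}

namespace GateList

/-! ### Input variables wired directly into gates -/

/-- The input variables wired DIRECTLY into the gate `g` (`{i | ∃ a, g.args a = inl i}`).
(Jukna 2012, §1.2.) [folklore] -/
def gateInputs [DecidableEq ι] (g : Gate ι) : Finset ι :=
  univ.biUnion fun a => Sum.elim (fun i => ({i} : Finset ι)) (fun _ => ∅) (g.args a)

/-- An input wire of `g` contributes its variable to `gateInputs g`. [folklore] -/
theorem mem_gateInputs_of_args_eq [DecidableEq ι] {g : Gate ι} {a : Fin g.arity} {i : ι}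
    (h : g.args a = .inl i) : i ∈ gateInputs g := by
  simp only [gateInputs, mem_biUnion, mem_univ, true_and]
  exact ⟨a, by rw [h]; simp⟩

/-- A gate reads directly at most fan-in many input variables. [folklore] -/
theorem card_gateInputs_le [DecidableEq ι] (g : Gate ι) : (gateInputs g).card ≤ g.arity := by
  unfold gateInputs
  calc (univ.biUnion fun a => Sum.elim (fun i => ({i} : Finset ι)) (fun _ => ∅) (g.args a)).card
      ≤ ∑ a, (Sum.elim (fun i => ({i} : Finset ι)) (fun _ => ∅) (g.args a)).card := card_biUnion_le
    _ ≤ ∑ _a : Fin g.arity, 1 := sum_le_sum fun a _ => by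
        cases g.args a with
        | inl i => simp
        | inr m => simp
    _ = g.arity := by simp

/-- The input variables wired directly into SOME gate of the program `gs`. [folklore] -/
def inputsRead [DecidableEq ι] : List (Gate ι) → Finset ι
  | [] => ∅
  | g :: gs => gateInputs g ∪ inputsRead gs

/-- Membership in `inputsRead`. [folklore] -/
theorem mem_inputsRead_iff [DecidableEq ι] {gs : List (Gate ι)} {i : ι} :
    i ∈ inputsRead gs ↔ ∃ g ∈ gs, i ∈ gateInputs g := by
  induction gs with
  | nil => simp [inputsRead]
  | cons g gs ih => simp [inputsRead, ih, or_and_right, exists_or]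

/-- **A program reads directly at most `wires = Σ fan-in` input variables.** [folklore] -/
theorem card_inputsRead_le [DecidableEq ι] (gs : List (Gate ι)) :
    (inputsRead gs).card ≤ (gs.map Gate.arity).sum := by
  induction gs with
  | nil => simp [inputsRead]
  | cons g gs ih =>
    simp only [inputsRead, List.map_cons, List.sum_cons]
    exact (card_union_le _ _).trans (Nat.add_le_add (card_gateInputs_le g) ih)

/-- **Every dependency set (backward light cone of a gate) consists of input variables wired
directly into some gate of the program.** [folklore] -/
theorem getD_deps_subset_inputsRead [DecidableEq ι] (gs : List (Gate ι)) (m : ℕ) :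
    (deps gs).getD m ∅ ⊆ inputsRead gs := by
  induction gs using List.reverseRecOn generalizing m with
  | nil => simp [deps]
  | append_singleton gs g ih =>
    have hmono : inputsRead gs ⊆ inputsRead (gs ++ [g]) := fun i hi => by
      obtain ⟨g', hg', hi⟩ := mem_inputsRead_iff.1 hi
      exact mem_inputsRead_iff.2 ⟨g', List.mem_append_left _ hg', hi⟩
    rw [deps_append_singleton]
    rcases Nat.lt_or_ge m gs.length with hm | hm
    · rw [List.getD_append _ _ _ _ (by simpa using hm)]
      exact (ih m).trans hmono
    · rcases hm.eq_or_lt with hm | hm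
      · rw [← hm, List.getD_append_right _ _ _ _ (by simp)]
        simp only [length_deps, Nat.sub_self, List.getD_cons_zero]
        intro i hi
        rw [mem_depOf_iff] at hi
        obtain ⟨a, ha | ⟨m', -, hi'⟩⟩ := hi
        · exact mem_inputsRead_iff.2
            ⟨g, List.mem_append_right _ (List.mem_singleton_self g), mem_gateInputs_of_args_eq ha⟩
        · exact hmono (ih m' hi')
      · rw [List.getD_eq_default _ _ (by simp; omega)]
        exact empty_subset _

end GateList

namespace Circuit

/-- **A circuit with `w` wires reads at most `w + 1` input variables** (its light cone lies in the
set of variables wired into gates, plus possibly an output wire that is an input) — for ANY gate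
basis and depth. [folklore] -/
theorem card_lightCone_le_wires_succ [DecidableEq ι] (C : Circuit ι) :
    C.lightCone.card ≤ C.wires + 1 := by
  show C.lightCone.card ≤ (C.gates.map Gate.arity).sum + 1
  unfold lightCone
  cases C.output with
  | inl i => simp
  | inr m =>
    exact ((card_le_card (GateList.getD_deps_subset_inputsRead C.gates m)).trans
      (GateList.card_inputsRead_le C.gates)).trans (Nat.le_succ _)

end Circuit

end Literature.Computability.Complexity

namespace Literature.Computability.MetaComplexity

open Literature.Computability.Complexity Literature.Computability.Complexity.Circuit
open Literature.Computability.MetaComplexity.ChenJinWilliams2019 (TCdWIRESae TCdWIRESae_mono ltfBasis)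
open scoped Classical

/-! ### The family form: a.e. threshold circuits with few wires are juntas -/

/-- **A.e. families of threshold circuits of any depth `D` with `s(n)` wires do not decide a
promise problem which infinitely often has a YES instance and `< 2^{n - s(n) - 1}` non-NO instances
of length `n`** (`card_lightCone_le_wires_succ` +
`OliveiraSanthanam2018.not_mem_promiseLift_FamilyAE_of_frequently`). [folklore] -/
theorem not_mem_promiseLift_TCdWIRESae_of_frequently {P : PromiseProblem} {D : ℕ} {s : ℕ → ℕ}
    (h : ∃ᶠ n : ℕ in atTop, (∃ y : Fin n → Bool, List.ofFn y ∈ P.yes) ∧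
      #{z : Fin n → Bool | List.ofFn z ∉ P.no} < 2 ^ (n - (s n + 1))) :
    P ∉ promiseLift (TCdWIRESae D s) :=
  OliveiraSanthanam2018.not_mem_promiseLift_FamilyAE_of_frequently
    (Q := fun n (C : Circuit (Fin n)) => C.IsOver ltfBasis ∧ C.acDepth ≤ D ∧ C.wires ≤ s n)
    (k := fun n => s n + 1)
    (fun _ C hC => C.card_lightCone_le_wires_succ.trans (Nat.succ_le_succ hC.2.2)) h

namespace OliveiraPichSanthanam2019

/-! ### Row R20 item 4: `Gap-MKtP` against threshold circuits with sublinearly many wires -/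

/-- **`Gap-MKtP[s₁, s₂]` against `TC`-circuits with `s` wires (family form).** If infinitely often
some string of length `N` has `Kt ≤ s₁ N` and `s₂ N + s N + 2 ≤ N`, then
`Gap-MKtP[s₁, s₂] ∉ promiseLift (TCdWIRESae D s)` for every depth `D` (`gapMKtP_count`). [folklore] -/
theorem gapMKtP_not_mem_promiseLift_TCdWIRESae (U : UniversalMachine) (D : ℕ) {s₁ s₂ s : ℕ → ℕ}
    (h : ∃ᶠ N : ℕ in atTop, (∃ y : List Bool, y.length = N ∧ U.levinKt y ≤ s₁ N) ∧
      s₂ N + s N + 2 ≤ N) :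
    U.gapMKtP s₁ s₂ ∉ promiseLift (TCdWIRESae D s) :=
  not_mem_promiseLift_TCdWIRESae_of_frequently
    (h.mono fun N hN => gapMKtP_count U s₁ s₂ (fun n => s n + 1) hN.1
      (by show s₂ N + (s N + 1) + 1 ≤ N; have := hN.2; omega))

/-- **Row R20 item 4, KNOWN (class form)**: `Gap-MKtP[⌊N^β⌋, ⌊N^β + c·log₂ N⌋] ∉ promiseLift
(TCdWIRESae D (N ↦ N − ⌈N^{β'}⌉))` for `0 < β < β' < 1` and EVERY depth `D` — no language consistent
with the promise has a.e. threshold circuits with `N − ⌈N^{β'}⌉` wires. [folklore] -/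
theorem gapMKtP_not_mem_TCdWIRESae_sublinear (U : UniversalMachine) (D c : ℕ) {β β' : ℝ}
    (hβ : 0 < β) (hββ' : β < β') (hβ'1 : β' < 1) :
    U.gapMKtP (UniversalMachine.powThreshold β) (UniversalMachine.powLogThreshold β c) ∉
      promiseLift (TCdWIRESae D fun N => N - ⌈(N : ℝ) ^ β'⌉₊) := by
  refine gapMKtP_not_mem_promiseLift_TCdWIRESae U D (Eventually.frequently ?_)
  obtain ⟨N₀, hN₀⟩ := U.eventually_ones_mem_MKtP_powThreshold hβ
  filter_upwards [eventually_ge_atTop N₀,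
    eventually_powLogThreshold_add_le hββ' (hβ.trans hββ') hβ'1.le c] with N hN hnum
  refine ⟨⟨ones N, by simp, ?_⟩, hnum⟩
  have h' : U.levinKt (ones N) ≤ UniversalMachine.powThreshold β (ones N).length := hN₀ N hN
  simpa using h'

/-- **Row R20 item 4, KNOWN column, in the vocabulary of OPS Theorem 1.1 item 4.** For every `U`,
every depth `D`, every `c`, `β ∈ (0, 1)` and EVERY wires exponent `κ < 1`:
`GapMKtPTCWiresLB U D c κ β` (`Gap-MKtP[2^{βn}, 2^{βn}+cn] ∉ TC_D[N^κ wires]`), unconditionally; the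
row NEEDS `κ = majExp d' ε = 1 + 2/d' + ε` at `D = majDepth d d'` (`MKtPMajHypothesis U c d d'`).
The same-model gap is the wires exponent: `1⁻` proved (all depths) versus `1 + 2/d' + ε` needed.
[cite: OliveiraPichSanthanam2021, Thm. 1.1 item 4 (hypothesis shape; folklore known bound)] -/
theorem gapMKtPTCWiresLB_of_lt_one (U : UniversalMachine) (D c : ℕ) {κ β : ℝ} (hκ : κ < 1)
    (hβ : 0 < β) (hβ1 : β < 1) : GapMKtPTCWiresLB U D c κ β := by
  obtain ⟨β', hββ', hκβ', hβ'1⟩ := exists_exponent_between hβ1 hκ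
  intro hmem
  exact gapMKtP_not_mem_TCdWIRESae_sublinear U D c hβ hββ' hβ'1
    (promiseLift_mono (TCdWIRESae_mono D (eventually_powSize_le_sub_ceil hκβ' (hβ.trans hββ') hβ'1))
      hmem)

/-- The `∃ β₀ ∀ β < β₀` form matching the row's quantifier shape (`β₀ = 1`): for every depth `D`
and every `κ < 1`, `MKtPMajHypothesis` with `majDepth d d'` replaced by `D` and `majExp d' ε` by `κ`
holds outright. [cite: OliveiraPichSanthanam2021, Thm. 1.1 item 4 (hypothesis shape; folklore known bound)] -/
theorem gapMKtP_tcWires_known_forall (U : UniversalMachine) (D c : ℕ) {κ : ℝ} (hκ : κ < 1) :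
    ∃ β₀ : ℝ, 0 < β₀ ∧ ∀ β : ℝ, 0 < β → β < β₀ → GapMKtPTCWiresLB U D c κ β :=
  ⟨1, one_pos, fun _ hβ hβ1 => gapMKtPTCWiresLB_of_lt_one U D c hκ hβ hβ1⟩

/-- **Decision version in exponent form**: for every depth `D`, `κ < 1` and `β ∈ (0, 1)`, the
language `MKtP[⌊N^β + c·log₂ N⌋]` has no a.e. threshold circuits with `⌊N^κ⌋` wires. [folklore] -/
theorem MKtP_powLogThreshold_not_mem_TCdWIRESae_powSize (U : UniversalMachine) (D c : ℕ) {κ β : ℝ}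
    (hκ : κ < 1) (hβ : 0 < β) (hβ1 : β < 1) :
    U.MKtP (UniversalMachine.powLogThreshold β c) ∉ TCdWIRESae D (powSize κ) :=
  fun hmem => gapMKtPTCWiresLB_of_lt_one U D c hκ hβ hβ1
    (U.gapMKtP_mem_promiseLift_of_MKtP_mem
      (fun N => powThreshold_le_powLogThreshold β c N) hmem)

end OliveiraPichSanthanam2019

namespace ChenJinWilliams2019

open Literature.Computability.MetaComplexity.ChenJinWilliams2020 (sliceFn circuitFns)

/-! ### Row R52 item 7: `search-MCSP[s]` against `TC`-circuits with few wires per output bit -/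

/-- **`search-MCSP[s]` is not solved at `m ≥ 1` with threshold circuits of `w(2^m)` wires per output
bit (any depth `D`) when the count at `s(m)` is `< 2^{2^m - w(2^m) - 1}`**: output `0` would be a
circuit reading `≤ w(2^m) + 1` inputs (`card_lightCone_le_wires_succ`) computing the `MCSP[s]`
indicator, whose fibre through the truth table of a projection consists of `≥ 2^{2^m - w(2^m) - 1}`
non-NO instances of `MCSP[s, s]`. [folklore] -/
theorem not_searchMCSPSolvableAt_tcWires {s w : ℕ → ℕ} {D m : ℕ} (hm : 1 ≤ m)
    (h : (s m + 1) * (16 * (m + s m + 1) ^ 2) ^ s m * (m + s m + 1) <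
      2 ^ (2 ^ m - w (2 ^ m) - 1)) :
    ¬ SearchMCSPSolvableAt (tcWireFns D w) s m := by
  classical
  intro hS
  obtain ⟨C, hC, hCf⟩ := sliceFn_mem_of_searchMCSPSolvableAt hS
  obtain ⟨y, hy⟩ := exists_ofFn_mem_gapMCSP_yes s s hm
  have hfy : sliceFn (MCSPSize s) (2 ^ m) y = true := (Set.mem_iff_boolIndicator _ _).1 hy
  have hcone : C.lightCone.card ≤ w (2 ^ m) + 1 :=
    C.card_lightCone_le_wires_succ.trans (Nat.succ_le_succ hC.2.2)
  have h1 : 2 ^ (2 ^ m - w (2 ^ m) - 1) ≤ #{x : Fin (2 ^ m) → Bool | C.eval x = C.eval y} :=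
    calc 2 ^ (2 ^ m - w (2 ^ m) - 1) ≤ 2 ^ (Fintype.card (Fin (2 ^ m)) - C.lightCone.card) :=
          Nat.pow_le_pow_right (by norm_num) (by simp only [Fintype.card_fin]; omega)
      _ ≤ _ := C.two_pow_le_card_filter_eval_eq y
  have h2 : #{x : Fin (2 ^ m) → Bool | C.eval x = C.eval y} ≤
      #{x : Fin (2 ^ m) → Bool | List.ofFn x ∉ (gapMCSP s s).no} := by
    refine card_le_card fun x hx => ?_
    simp only [mem_filter, mem_univ, true_and] at hx ⊢
    rw [hCf x, hCf y, hfy] at hx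
    have hxyes : List.ofFn x ∈ (gapMCSP s s).yes := (Set.mem_iff_boolIndicator _ _).2 hx
    exact Set.disjoint_left.1 (gapMCSP_disjoint (a := s) (b := s) fun _ => le_rfl) hxyes
  exact absurd ((h1.trans h2).trans (card_filter_ofFn_not_mem_gapMCSP_no_le s s m)) (not_le.2 h)

/-- **`search-MCSP[s]` with `s(m) ≤ ⌈2^{βm}⌉` eventually is not solved with `N − ⌈N^{β'}⌉` wires per
output bit at any large `m`, at any depth `D`**, for `0 ≤ β < β' < 1`
(`eventually_circuitCount_noBound_lt`). [folklore] -/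
theorem eventually_not_searchMCSPSolvableAt_tcWires {s : ℕ → ℕ} (D : ℕ) {β β' : ℝ} (hβ : 0 ≤ β)
    (hββ' : β < β') (hβ'1 : β' < 1)
    (hs : ∀ᶠ m : ℕ in atTop, s m ≤ OliveiraPichSanthanam2019.noBound β m) :
    ∀ᶠ m : ℕ in atTop,
      ¬ SearchMCSPSolvableAt (tcWireFns D fun N => N - ⌈(N : ℝ) ^ β'⌉₊) s m := by
  filter_upwards [eventually_circuitCount_noBound_lt hβ hββ' hβ'1, hs, eventually_ge_atTop 1]
    with m hm hsm hm1
  exact not_searchMCSPSolvableAt_tcWires hm1 ((circuitCount_mono m hsm).trans_lt hm)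

/-- **Row R52 item 7, KNOWN side in the same model.** For every `s` in the regime of Thm. 1.6 and
every depth `D` there is `β₀ < 1` such that for every `β' ∈ (β₀, 1)`, `search-MCSP[s]` is not solved
with `N − ⌈N^{β'}⌉` wires per output bit at any large `m` (item 7 needs `⌈N^{1+ε}⌉` wires at depth
`tcDepth c₀ d ε` for SOME `ε ∈ (0,1)`; `sub_ceil_lt_powCeil`).
[cite: ChenJinWilliams2019, Thm. 1.6 item 7 (hypothesis shape; known side folklore)] -/
theorem searchMCSP_tcWires_known_sublinear {s : ℕ → ℕ} (hs : SizeRegime s) (D : ℕ) :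
    ∃ β₀ : ℝ, β₀ < 1 ∧ ∀ β' : ℝ, β₀ < β' → β' < 1 → ∀ᶠ m : ℕ in atTop,
      ¬ SearchMCSPSolvableAt (tcWireFns D fun N => N - ⌈(N : ℝ) ^ β'⌉₊) s m := by
  obtain ⟨β, hβ0, hβ1, hev⟩ := hs.exists_eventually_le_noBound
  exact ⟨β, hβ1, fun β' hββ' hβ'1 => eventually_not_searchMCSPSolvableAt_tcWires D hβ0 hββ' hβ'1 hev⟩

/-- The row's own size parameter `⌊2^{βm}⌋` is at most the counting threshold `⌈2^{βm}⌉`. [folklore] -/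
theorem twoPowFloor_le_noBound (β : ℝ) (m : ℕ) :
    twoPowFloor β m ≤ OliveiraPichSanthanam2019.noBound β m := by
  unfold twoPowFloor OliveiraPichSanthanam2019.noBound
  exact Nat.floor_le_ceil _

/-- **Row R52 item 7 at the row's own parameter `s(m) = ⌊2^{βm}⌋`**: for every depth `D` and
`0 < β < β' < 1`, `search-MCSP[2^{βm}]` is not solved with `N − ⌈N^{β'}⌉` wires per output bit at
any large `m` — unconditionally. [cite: ChenJinWilliams2019, Thm. 1.6 item 7 (hypothesis shape; known side folklore)] -/
theorem eventually_not_searchMCSPSolvableAt_tcWires_twoPowFloor (D : ℕ) {β β' : ℝ} (hβ : 0 < β)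
    (hββ' : β < β') (hβ'1 : β' < 1) :
    ∀ᶠ m : ℕ in atTop,
      ¬ SearchMCSPSolvableAt (tcWireFns D fun N => N - ⌈(N : ℝ) ^ β'⌉₊) (twoPowFloor β) m :=
  eventually_not_searchMCSPSolvableAt_tcWires D hβ.le hββ' hβ'1
    (Eventually.of_forall fun m => twoPowFloor_le_noBound β m)

/-- **The KNOWN and NEEDED wire budgets of item 7 never cross**: `N − ⌈N^{β'}⌉ < ⌈N^e⌉ = powCeil e N`
for `N ≥ 1` and every exponent `e ≥ 1` (item 7: `e = 1 + ε`). [folklore] -/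
theorem sub_ceil_lt_powCeil {N : ℕ} (hN : 1 ≤ N) {e : ℝ} (he : 1 ≤ e) (β' : ℝ) :
    N - ⌈(N : ℝ) ^ β'⌉₊ < powCeil e N := by
  have hN' : (1 : ℝ) ≤ N := by exact_mod_cast hN
  have h1 : 1 ≤ ⌈(N : ℝ) ^ β'⌉₊ :=
    Nat.one_le_iff_ne_zero.2 (Nat.ceil_pos.2 (Real.rpow_pos_of_pos (by positivity) _)).ne'
  have h2 : N ≤ powCeil e N := by
    have h : (N : ℝ) ≤ (N : ℝ) ^ e := by
      simpa using Real.rpow_le_rpow_of_exponent_le hN' he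
    unfold powCeil
    exact_mod_cast h.trans (Nat.le_ceil _)
  omega

/-! ### Row R52-MKtP item 7: `search-MKtP[p]` against `TC`-circuits with few wires per output bit -/

/-- **Single-length form.** If `1^n ∈ MKtP[p]` and `p(n) + w(n) + 2 ≤ n`, then `search-MKtP[p]` is
not solved at length `n` by tuples of functions each having a threshold circuit (indeed any circuit)
with `≤ w(n)` wires: output `0` would solve `Gap-MKtP[p, p]` at length `n` while reading `≤ w(n) + 1`
inputs, but fewer than `2^{p(n)+1}` strings have `Kt ≤ p(n)` (`gapMKtP_count`,
`AtseriasMuller2025.not_solvesPromise_of_card_lt`). [folklore] -/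
theorem not_searchMKtPSolvableAt_tcWires (U : UniversalMachine) {p w : ℕ → ℕ} {D n : ℕ}
    (hyes : ones n ∈ U.MKtP p) (h : p n + w n + 2 ≤ n) :
    ¬ SearchMKtPSolvableAt U (tcWireFns D w) p n := by
  classical
  intro hS
  obtain ⟨E, hE, hcomp⟩ := sliceFn_MKtP_mem_of_searchMKtPSolvableAt U hS
  have hsol : E.SolvesPromise (U.gapMKtP p p) := by
    intro u
    have hu : E.eval u = (U.MKtP p).boolIndicator (List.ofFn u) := hcomp u
    refine ⟨fun hy => ?_, fun hn => ?_⟩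
    · rw [hu]; exact (Set.mem_iff_boolIndicator _ _).1 hy
    · rw [hu]
      refine (Set.notMem_iff_boolIndicator _ _).1 fun hy => ?_
      rw [UniversalMachine.mem_gapMKtP_no_iff] at hn
      exact absurd (lt_of_lt_of_le hn hy) (lt_irrefl _)
  have hy : ∃ y : List Bool, y.length = n ∧ U.levinKt y ≤ p n := by
    refine ⟨ones n, by simp, ?_⟩
    have h' : U.levinKt (ones n) ≤ (p (ones n).length : ℕ) := hyes
    simpa using h'
  obtain ⟨hyes', hlt⟩ := OliveiraPichSanthanam2019.gapMKtP_count U p p (fun k => w k + 1) hy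
    (by show p n + (w n + 1) + 1 ≤ n; omega)
  exact AtseriasMuller2025.not_solvesPromise_of_card_lt E
    (E.card_lightCone_le_wires_succ.trans (Nat.succ_le_succ hE.2.2)) hyes' hlt hsol

/-- **`search-MKtP[p]`, KNOWN side against threshold circuits with few wires.** For `p` in the
regime of Thm. 1.6 (`KtRegime p`) whose YES side eventually contains `1^n`, and every depth `D`,
there is `β₀ < 1` such that for every `β' ∈ (β₀, 1)`, `search-MKtP[p]` is not solved with
`N − ⌈N^{β'}⌉` wires per output bit at any large length (item 7 with `C = EXP` needs `⌈N^{1+ε}⌉`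
wires at depth `tcDepth c₀ d ε`).
[cite: ChenJinWilliams2019, Thm. 1.6 item 7, Moreover clause (hypothesis shape; known side folklore)] -/
theorem searchMKtP_tcWires_known_sublinear (U : UniversalMachine) (D : ℕ) {p : ℕ → ℕ}
    (hp : KtRegime p) (hyes : ∀ᶠ n : ℕ in atTop, ones n ∈ U.MKtP p) :
    ∃ β₀ : ℝ, β₀ < 1 ∧ ∀ β' : ℝ, β₀ < β' → β' < 1 → ∀ᶠ n : ℕ in atTop,
      ¬ SearchMKtPSolvableAt U (tcWireFns D fun N => N - ⌈(N : ℝ) ^ β'⌉₊) p n := by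
  obtain ⟨c, hc1, hev⟩ := hp.2
  refine ⟨max c 0, max_lt hc1 one_pos, fun β' hβ₀ hβ'1 => ?_⟩
  have hcβ' : c < β' := (le_max_left c 0).trans_lt hβ₀
  have hβ'0 : 0 < β' := (le_max_right c 0).trans_lt hβ₀
  filter_upwards [hev, hyes, eventually_powLogThreshold_add_le hcβ' hβ'0 hβ'1.le 0] with n hn hy hnum
  refine not_searchMKtPSolvableAt_tcWires U hy ?_
  have hpn : p n ≤ UniversalMachine.powLogThreshold c 0 n := by
    refine (Nat.le_floor hn).trans ?_
    exact OliveiraPichSanthanam2019.powThreshold_le_powLogThreshold c 0 n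
  omega

/-- The row's parameter `rpowFloor β = ⌊n^β⌋` is the tree's `UniversalMachine.powThreshold β`.
[folklore] -/
theorem rpowFloor_eq_powThreshold (β : ℝ) : rpowFloor β = UniversalMachine.powThreshold β := rfl

/-- **Row R52-MKtP item 7 at the row's own parameter `p = ⌊n^β⌋`** (`0 < β < β' < 1`): for every
depth `D`, `search-MKtP[n^β]` is not solved with `N − ⌈N^{β'}⌉` wires per output bit at any large
length — unconditionally, for every universal machine. [cite: ChenJinWilliams2019, Thm. 1.6 item 7, Moreover clause (hypothesis shape; known side folklore)] -/
theorem eventually_not_searchMKtPSolvableAt_tcWires_rpowFloor (U : UniversalMachine) (D : ℕ)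
    {β β' : ℝ} (hβ : 0 < β) (hββ' : β < β') (hβ'1 : β' < 1) :
    ∀ᶠ n : ℕ in atTop, ¬ SearchMKtPSolvableAt U (tcWireFns D fun N => N - ⌈(N : ℝ) ^ β'⌉₊)
      (rpowFloor β) n := by
  rw [rpowFloor_eq_powThreshold]
  obtain ⟨N₀, hN₀⟩ := U.eventually_ones_mem_MKtP_powThreshold hβ
  filter_upwards [eventually_ge_atTop N₀,
    eventually_powLogThreshold_add_le hββ' (hβ.trans hββ') hβ'1.le 0] with n hn hnum
  refine not_searchMKtPSolvableAt_tcWires U (hN₀ n hn) ?_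
  have := OliveiraPichSanthanam2019.powThreshold_le_powLogThreshold β 0 n
  omega

end ChenJinWilliams2019

end Literature.Computability.MetaComplexity
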